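import Literature.AlgebraicGeometry.Frobenioids.ArchimedeanIsotropyPropagation
import Literature.AlgebraicGeometry.Frobenioids.ArchimedeanArcs
import Literature.AlgebraicGeometry.Frobenioids.AngularRegionTensor
import HarnessLib

/-!
# Frobenioids II, Remark 3.3.1 for `C`: a monomorphism is injective on angular regions — PROOF

Mochizuki, *The geometry of Frobenioids II: poly-Frobenioids*, Kyushu J. Math. **62** (2008)
401–460, §3, Remark 3.3.1 p. 29 [cite: MochizukiFrdII2008, Rmk 3.3.1 p.29]: "in any of the categories
`C`, `A`, `N`, or `R`, a base-isomorphism between complex objects is a monomorphism if and only if it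
induces an injection on underlying angular regions."

`ArchimedeanIsotropy.lean` proves (⇐) for `C` (`Rmk331_C_mono_of_injOn`). This file proves (⇒) for
`C` and DISCHARGES all four named statements `ArchFrd.Rmk331_C/A/N/R π`: if `a ↦ c · a^d` identifies
two points `a₁ ≠ a₂` of `A_X` (so `a₂ = ζ a₁` with `ζ^d = 1`, `|ζ| = 1`), the NARROW complex test
object `W` whose angular part is a small arc around the direction of `a₁` (`ArchimedeanArcs.lean`), of
the same tip and base data as `X`, carries two different LINEAR ISOMETRIES `(id, 1, 1), (id, 1, ζ) :
W ⇉ X` equalised by `φ` (`C.exists_testPair`) — contradicting `Mono φ` in `C` and in `A`. In `N` and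
`R` all arrows are linear, so injectivity holds outright and the content is (⇐), obtained from `C` via
the faithful functors `N → C`, `R → C`. (Multiplicativity of the angular part, `ArchFrd.unitPart_mul`, is
the tree's `AngularRegionTensor.lean`.)
-/

namespace Literature.AlgebraicGeometry.Frobenioids

open CategoryTheory Opposite
open scoped Pointwise NNReal

noncomputable section

namespace ArchFrd

/-- The angular part of a unit of norm `1` is itself. [cite: MochizukiFrdII2008, Def 3.1 (ii) p.24] -/
theorem unitPart_coe_normOne (z : normOneSubgroup ℂ) : unitPart ℂ (z : ℂˣ) = z := by
  have h := unitPart_coe_mul_ofPosReal z 1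
  rwa [map_one, mul_one] at h

/-- Arcs grow with their half-width. [cite: MochizukiFrdII2008, Def 3.1 (iii) p.24] -/
theorem arcDir_mono (w : normOneSubgroup ℂ) {ε ε' : ℝ} (h : ε ≤ ε') : arcDir w ε ⊆ arcDir w ε' :=
  fun _ hz => ⟨by linarith [hz.1], by linarith [hz.2]⟩

universe v u

variable {D : Type u} [Category.{v} D] (π : D ⥤ D0)

/-- The map `a ↦ c · a^d` of a LINEAR arrow (`d = 1`) is injective (everywhere).
[cite: MochizukiFrdII2008, Rmk 3.3.1 p.29] -/
theorem C0.injOn_regionMap_of_degFr_eq_one {X Y : C0} (ψ : X ⟶ Y) (h : C0.degFr ψ = 1)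
    (S : Set ℂˣ) : Set.InjOn (C0.regionMap ψ) S := by
  intro a₁ _ a₂ _ heq
  have h' := mul_left_cancel heq
  rwa [h, PNat.one_coe, pow_one, pow_one] at h'

/-- The core of Remark 3.3.1: if `a ↦ c · a^d` identifies two points `a₁ ≠ a₂` of `A_X` (`X` complex),
then the narrow test object `W` (small arc around the direction of `a₁`, tip `tip(A_X)`, same base
data as `X`) carries two DIFFERENT linear isometries `(id, 1, 1), (id, 1, a₂/a₁) : W ⇉ X` equalised
by `φ`. [cite: MochizukiFrdII2008, Rmk 3.3.1 p.29] -/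
theorem C.exists_testPair {X Y : C π} (φ : X ⟶ Y) (hX : X.fst.IsComplexObj) {a₁ a₂ : ℂˣ}
    (ha₁ : a₁ ∈ X.fst.region.carrier) (ha₂ : a₂ ∈ X.fst.region.carrier)
    (heq : C0.regionMap φ.fst a₁ = C0.regionMap φ.fst a₂) (hne : a₁ ≠ a₂) :
    ∃ (W : C π) (g h : W ⟶ X), g ≠ h ∧ g ≫ φ = h ≫ φ ∧
      PreFrobenioid.IsIsometry (C.toElem π) g ∧ PreFrobenioid.IsIsometry (C.toElem π) h ∧
      C0.degFr g.fst = 1 ∧ C0.degFr h.fst = 1 := by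
  -- `a₁^d = a₂^d`, `ζ := a₂ a₁⁻¹` has `ζ^d = 1` and norm `1`
  have hd : a₁ ^ (C0.degFr φ.fst : ℕ) = a₂ ^ (C0.degFr φ.fst : ℕ) := mul_left_cancel heq
  have hnorm : ‖(a₁ : ℂ)‖ = ‖(a₂ : ℂ)‖ := by
    have h := congrArg (fun u : ℂˣ => ‖(u : ℂ)‖) hd
    simp only [Units.val_pow_eq_pow_val, norm_pow] at h
    exact (pow_left_inj₀ (norm_nonneg _) (norm_nonneg _) (C0.degFr φ.fst).ne_zero).mp h
  set ζ : ℂˣ := a₂ * a₁⁻¹ with hζ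
  have hζd : ζ ^ (C0.degFr φ.fst : ℕ) = 1 := by
    rw [hζ, mul_pow, inv_pow, ← hd, mul_inv_cancel]
  have hζ1 : ‖(ζ : ℂ)‖ = 1 := by
    rw [hζ, Units.val_mul, Units.val_inv_eq_inv_val, norm_mul, norm_inv, ← hnorm,
      mul_inv_cancel₀ (norm_ne_zero_iff.mpr a₁.ne_zero)]
  have hζn : ζ ∈ normOneSubgroup ℂ := by rw [mem_normOneSubgroup_iff]; exact hζ1
  set ζu : normOneSubgroup ℂ := ⟨ζ, hζn⟩ with hζu
  have ha₂ζ : a₂ = ζ * a₁ := by rw [hζ, inv_mul_cancel_right]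
  -- directions and a common small arc inside the (open) angular part of `X`
  set w₁ := unitPart ℂ a₁ with hw₁
  have hw₂ : unitPart ℂ a₂ = ζu * w₁ := by
    rw [ha₂ζ, unitPart_mul, hw₁]
    congr 1
    exact unitPart_coe_normOne ζu
  obtain ⟨ε₁, hε₁, hε₁π, h₁⟩ := exists_arcDir_subset X.fst.region.isOpen_dir ha₁.1
  obtain ⟨ε₂, hε₂, -, h₂⟩ := exists_arcDir_subset X.fst.region.isOpen_dir ha₂.1
  have hε : 0 < min ε₁ ε₂ := lt_min hε₁ hε₂
  have hεπ : min ε₁ ε₂ < Real.pi := lt_of_le_of_lt (min_le_left _ _) hε₁π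
  -- the narrow object `W` over the same base data as `X`, with the same tip
  let W₀ : C0 := ⟨X.fst.base, arcRegion w₁ (min ε₁ ε₂) hε hεπ X.fst.region.tip,
    fun h => D0.noConfusion (h.symm.trans hX)⟩
  let W : C π := ⟨W₀, X.snd, X.iso⟩
  have hmemX : ∀ u : ℂˣ, u ∈ W₀.region.carrier → unitPart ℂ u ∈ X.fst.region.dir →
      u ∈ X.fst.region.carrier := fun u hu h1 => ⟨h1, hu.2⟩
  -- the two arrows `(id, 1, 1)` and `(id, 1, ζ)` of `C₀`
  let g₀ : W₀ ⟶ X.fst :=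
    { base := 𝟙 _, degFr := 1, scalar := 1, scalar_mem := one_mem _,
      mapsTo := by
        rw [one_smul, PNat.one_coe, pow_one]
        change W₀.region.carrier ⊆ C0.pullRegion X.fst (𝟙 X.fst.base)
        rw [C0.pullRegion_id]
        intro u hu
        exact hmemX u hu (h₁ (arcDir_mono w₁ (min_le_left _ _) hu.1)) }
  have hζs : ζ ∈ D0.scalars X.fst.base := by
    rw [show X.fst.base = D0.complex from hX]; exact Subgroup.mem_top _
  let h₀ : W₀ ⟶ X.fst :=
    { base := 𝟙 _, degFr := 1, scalar := ζ, scalar_mem := hζs,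
      mapsTo := by
        rw [PNat.one_coe, pow_one]
        change ζ • W₀.region.carrier ⊆ C0.pullRegion X.fst (𝟙 X.fst.base)
        rw [C0.pullRegion_id]
        rintro _ ⟨u, hu, rfl⟩
        refine ⟨?_, ?_⟩
        · have hdir : unitPart ℂ (ζ • u) = ζu * unitPart ℂ u := by
            rw [smul_eq_mul, unitPart_mul, unitPart_coe_normOne ζu]
          rw [hdir]
          apply h₂
          rw [hw₂]
          exact (mem_arcDir_mul_iff ζu w₁ _ _).mpr (arcDir_mono w₁ (min_le_right _ _) hu.1)
        · have hn : absHom ℂ (ζ • u) = absHom ℂ u := by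
            apply Subtype.ext
            rw [coe_absHom, coe_absHom, smul_eq_mul, Units.val_mul, norm_mul, hζ1, one_mul]
          rw [hn]
          exact hu.2 }
  have hw : ∀ (k : W₀ ⟶ X.fst), C0.Base k = 𝟙 _ →
      (PreFrobenioid.baseFunctor C0.toElem).map k ≫ X.iso.hom = X.iso.hom ≫ π.map (𝟙 X.snd) :=
    fun k hk => by
      change C0.Base k ≫ X.iso.hom = X.iso.hom ≫ π.map (𝟙 X.snd)
      rw [hk, Category.id_comp, CategoryTheory.Functor.map_id, Category.comp_id]
  let g : W ⟶ X := ⟨g₀, 𝟙 X.snd, hw g₀ rfl⟩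
  let h : W ⟶ X := ⟨h₀, 𝟙 X.snd, hw h₀ rfl⟩
  refine ⟨W, g, h, ?_, ?_, ?_, ?_, rfl, rfl⟩
  · -- different scalars
    intro hgh
    have hs : (1 : ℂˣ) = ζ := congrArg (fun k : W ⟶ X => C0.scalar k.fst) hgh
    apply hne
    rw [ha₂ζ, ← hs, one_mul]
  · -- `φ` equalises them (`ζ^d = 1`)
    refine CFP.hom_ext (C0.hom_ext rfl rfl ?_) rfl
    change (C0.Base g₀).act (C0.scalar φ.fst) * (1 : ℂˣ) ^ (C0.degFr φ.fst : ℕ) =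
      (C0.Base h₀).act (C0.scalar φ.fst) * ζ ^ (C0.degFr φ.fst : ℕ)
    rw [one_pow, hζd]
  · -- `g` is an isometry: `|1| · tip = tip`
    refine (A0.isIsometry_iff_norm_mul_tip_pow g₀).mpr ?_
    change ‖((1 : ℂˣ) : ℂ)‖ * (X.fst.tip : ℝ) ^ ((1 : ℕ+) : ℕ) = X.fst.tip
    rw [Units.val_one, norm_one, one_mul, PNat.one_coe, pow_one]
  · refine (A0.isIsometry_iff_norm_mul_tip_pow h₀).mpr ?_
    change ‖(ζ : ℂ)‖ * (X.fst.tip : ℝ) ^ ((1 : ℕ+) : ℕ) = X.fst.tip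
    rw [hζ1, one_mul, PNat.one_coe, pow_one]

/-- **Remark 3.3.1** for `C`, direction (⇒): a monomorphism `φ : X → Y` of `C` with `X` complex is
injective on the angular region of `X` under `a ↦ c · a^d` — PROVED with narrow test objects.
[cite: MochizukiFrdII2008, Rmk 3.3.1 p.29] -/
theorem Rmk331_C_injOn_of_mono {X Y : C π} (φ : X ⟶ Y) (hX : X.fst.IsComplexObj) [hm : Mono φ] :
    Set.InjOn (C0.regionMap φ.fst) X.fst.region.carrier := by
  intro a₁ ha₁ a₂ ha₂ heq
  by_contra hne
  obtain ⟨W, g, h, hgh, hcomp, -⟩ := C.exists_testPair π φ hX ha₁ ha₂ heq hne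
  exact hgh (hm.right_cancellation g h hcomp)

/-- **Remark 3.3.1** for `C` — PROVED (both directions: `Rmk331_C_injOn_of_mono` and
`Rmk331_C_mono_of_injOn`). [cite: MochizukiFrdII2008, Rmk 3.3.1 p.29] -/
theorem Rmk331_C_holds : Rmk331_C π := by
  intro X Y φ hX _ hbase
  constructor
  · intro hm
    exact Rmk331_C_injOn_of_mono π φ hX
  · exact Rmk331_C_mono_of_injOn π φ hbase

/-- **Remark 3.3.1** for `A` — PROVED: (⇒) the test arrows are linear isometries, i.e. arrows of `A`;
(⇐) a monomorphism of `C` between objects of `A` is a monomorphism of `A` (faithful inclusion).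
[cite: MochizukiFrdII2008, Rmk 3.3.1 p.29] -/
theorem Rmk331_A_holds : Rmk331_A π := by
  intro X Y φ hX _ hbase
  constructor
  · intro hm a₁ ha₁ a₂ ha₂ heq
    by_contra hne
    obtain ⟨W, g, h, hgh, hcomp, hg, hh, -⟩ := C.exists_testPair π φ.hom hX ha₁ ha₂ heq hne
    let W' : A π := ⟨W⟩
    let g' : W' ⟶ X := ⟨g, hg⟩
    let h' : W' ⟶ X := ⟨h, hh⟩
    have hcomp' : g' ≫ φ = h' ≫ φ := WideSubcategory.hom_ext _ hcomp
    exact hgh (congrArg InducedWideCategory.Hom.hom (hm.right_cancellation g' h' hcomp'))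
  · intro hinj
    haveI : Mono φ.hom := Rmk331_C_mono_of_injOn π φ.hom hbase hinj
    exact (A.ι π).mono_of_mono_map (by exact (inferInstance : Mono φ.hom))

/-- **Remark 3.3.1** for `N` — PROVED: arrows of `N` are linear, so `a ↦ c · a` is injective outright,
and a base-isomorphism of `N` is a monomorphism (via `C` and the faithful functor `N → C`).
[cite: MochizukiFrdII2008, Rmk 3.3.1 p.29] -/
theorem Rmk331_N_holds : Rmk331_N π := by
  intro X Y φ _ _ hbase
  have hlin : C0.degFr ((N.toC π).map φ).fst = 1 := φ.property
  have hinj := C0.injOn_regionMap_of_degFr_eq_one ((N.toC π).map φ).fst hlin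
    X.obj.obj.fst.region.carrier
  refine ⟨fun _ => hinj, fun _ => ?_⟩
  haveI : Mono ((N.toC π).map φ) := Rmk331_C_mono_of_injOn π _ hbase hinj
  exact (N.toC π).mono_of_mono_map inferInstance

/-- `R → C` is faithful (an arrow of `R = R₀ ×_{D₀} D` is determined by its underlying `C₀`-arrow and
its `D`-component). [cite: MochizukiFrdII2008, Ex 3.3 (iv) p.29] -/
instance R.toC_faithful : (R.toC π).Faithful where
  map_injective := by
    intro X Y f g e
    have e₁ : R0.toC0.map f.fst = R0.toC0.map g.fst := by
      have := congrArg CFP.Hom.fst e; exact this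
    have e₂ : f.snd = g.snd := by
      have := congrArg CFP.Hom.snd e; exact this
    exact CFP.hom_ext (R0.toC0.map_injective e₁) e₂

/-- **Remark 3.3.1** for `R` — PROVED: arrows of `R` are linear (injectivity outright), and a
base-isomorphism of `R` is a monomorphism (via `C` and the faithful functor `R → C`).
[cite: MochizukiFrdII2008, Rmk 3.3.1 p.29] -/
theorem Rmk331_R_holds : Rmk331_R π := by
  intro X Y φ _ _ hbase
  have hlin : C0.degFr ((R.toC π).map φ).fst = 1 := φ.fst.left.property
  have hinj := C0.injOn_regionMap_of_degFr_eq_one ((R.toC π).map φ).fst hlin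
    ((R.toC π).obj X).fst.region.carrier
  refine ⟨fun _ => hinj, fun _ => ?_⟩
  haveI : Mono ((R.toC π).map φ) := Rmk331_C_mono_of_injOn π _ hbase hinj
  exact (R.toC π).mono_of_mono_map inferInstance

end ArchFrd

end

end Literature.AlgebraicGeometry.Frobenioids
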